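import Summits.ResolutionOfSingularities.ResolutionOfSingularities.Theorems.TameInertialLU
import Summits.ResolutionOfSingularities.ResolutionOfSingularities.Theorems.InertDescentLU5
import HarnessLib

/-!
# TameInertialLU (2/2) — the located residual R29, the cuts `R28 ↔ R29 ↔ R25 ↔ R23`, ROOT BY NAME `closes_tinert`

Part 2 of the g28-B node `TameInertialLU` of the ROOT/RESIDUAL decomposition cell `decomp-res` (lens 1, window (W-α),
cheap half (α1)); see the module docstring of
`Summits.ResolutionOfSingularities.ResolutionOfSingularities.Theorems.TameInertialLU` (part 1/2) for the thesis, the law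
`TameInertialLUAbove k O → RelLocalUniformization k K O` and the sources.  This part (imports `InertDescentLU5` for R28 and
`closes_inert`): `not_tameEquivariantLUAbove_of_not_tameInertialLUAbove`, the decided cell piece
`NonKHToricArchLUKeyHenselDescentQuotTInertCell` (`_holds`), the located residual R29
`NonKHToricArchLUKeyHenselDescentQuotTInert`
(docstring = the honest located remainder (α2) `μ_ℓ ⊄ K`, wild, defect), the exact cuts `…QuotInert_iff_tinert : R28 ↔ R29`,
`…Quot_iff_tinert : R25 ↔ R29`, `nonKHToricArchLUKeyHenselDescent_iff_tinert : R23 ↔ R29`, `nonKHToricArchLU_iff_tinert`,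
`…TInert_of_root`, `closes_tinert` (the summit by name, binders printed), `root_iff_tinert_sigma`.
Problem side, sorry-free, hypothesis-free.
-/

noncomputable section

open IntermediateField Polynomial Literature.AlgebraicGeometry.Resolution
open Summit.ResolutionOfSingularities.ResolutionOfSingularities.Theorems.TameQuotientLU

namespace Summit.ResolutionOfSingularities.ResolutionOfSingularities.Theorems.TameInertialLU

/-! ## PART H — the located residual `R29`, the exact cuts `R28 ↔ R29 ↔ R25 ↔ R23`, ROOT BY NAME `closes_tinert`
(slice `TameInertialLU2`, after `InertDescentLU5`) -/

section CutT

variable {k K : Type} [Field k] [Field K] [Algebra k K]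

open Summit.ResolutionOfSingularities.ResolutionOfSingularities.Theses
open Summit.ResolutionOfSingularities.ResolutionOfSingularities.Theorems
open Summit.ResolutionOfSingularities.ResolutionOfSingularities.Theorems.KeyChainLU
open Summit.ResolutionOfSingularities.ResolutionOfSingularities.Theorems.HenselKeyChainLU
open Summit.ResolutionOfSingularities.ResolutionOfSingularities.Theorems.GaloisDescentLU
open Summit.ResolutionOfSingularities.ResolutionOfSingularities.Theorems.PfaffLine
open Summit.ResolutionOfSingularities.ResolutionOfSingularities.Theorems.ToricLadder
open Summit.ResolutionOfSingularities.ResolutionOfSingularities.Theorems.KaplanskyLadder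
open Summit.ResolutionOfSingularities.ResolutionOfSingularities.Theorems.PerronLadder
open Summit.ResolutionOfSingularities.ResolutionOfSingularities.Theorems.DefectlessLadder
open Summit.ResolutionOfSingularities.ResolutionOfSingularities.Theorems.WCut
open Summit.ResolutionOfSingularities.ResolutionOfSingularities.Theorems.TameQuotientLU
open Summit.ResolutionOfSingularities.ResolutionOfSingularities.Theorems.DecompositionDescentLU
open Summit.ResolutionOfSingularities.ResolutionOfSingularities.Theorems.InertDescentLU

/-- `¬ TameInertial ⇒ ¬ TameEquivariant`: g25's tame-quotient cell lies INSIDE the tame-inertial cell, so the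
binder `¬ TameQuotientLU.TameEquivariantLUAbove k O` of the residuals below is implied by the new one. [folklore] -/
theorem not_tameEquivariantLUAbove_of_not_tameInertialLUAbove {O : ValuationSubring K}
    (h : ¬ TameInertialLUAbove k O) : ¬ TameQuotientLU.TameEquivariantLUAbove k O :=
  fun hT => h (tameInertialLUAbove_of_tameEquivariantLUAbove hT)

/-- The TAME-INERTIAL CELL PIECE of the residual family (tag DECIDED by `relLU_of_tameInertialLUAbove`): R28's
binders together with the tame-inertial cell give relative local uniformization. -/
def NonKHToricArchLUKeyHenselDescentQuotTInertCell (e c n : ℕ) : Prop :=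
  ∀ p : ℕ, p.Prime → ∀ (k K : Type) [Field k] [CharP k p] [Field K] [Algebra k K],
    Algebra.trdeg k K ≤ n → ∀ O : ValuationSubring K, Nonempty O.valuation.RankOne →
    (∀ y ∈ O, ∃ f : Polynomial k, f ≠ 0 ∧ Polynomial.aeval y f ∈ O.nonunits) →
    ¬ IsAbhyankarPlace O (algebraMap k K).fieldRange ⊤ →
    ¬ (∃ d : ℕ, d < n ∧ SepDenseBelow k O d) → ¬ ToricDenseBelow k O e → ¬ KHTopBelow k O c →
    ¬ KeyChainTopBelow k O → ¬ HenselKeyChainTopBelow k O → ¬ GaloisHenselDescentDatum k O →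
    ¬ TameQuotientLU.TameEquivariantLUAbove k O →
    ¬ DecompositionFieldLUAbove k O → ¬ DecWitnessLUAbove k O → ¬ UnramifiedWitnessLUAbove k O →
    TameInertialLUAbove k O → RelLocalUniformization k K O

/-- THE TAME-INERTIAL LAW DECIDES THE CELL PIECE outright (no port, no fact binder). [folklore] -/
theorem nonKHToricArchLUKeyHenselDescentQuotTInertCell_holds (e c n : ℕ) :
    NonKHToricArchLUKeyHenselDescentQuotTInertCell e c n :=
  fun _ _ _ _ _ _ _ _ _ _ _ _ _ _ _ _ _ _ _ _ _ _ _ hI => relLU_of_tameInertialLUAbove hI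

/-- **NEW LOCATED RESIDUAL `R29`** (tag UNDECIDED · WEAKER than the root · located at `(e, c, n) = (3, 3, 4)`):
the located residual OFF the key-chain, Hensel, descent, tame-quotient, decomposition-descent, residue-free witness
AND TAME-INERTIAL cells — in addition to R28's clauses, for NO finite cyclic Galois top `K′ | K` of order dividing
`ℓ ∈ k×` with `μ_ℓ ⊆ K`, whose generator fixes a valuation ring `O′` above `O` and acts trivially on its residue
field (`κ(O′) | k` algebraic), do the models of `K` embed in generator-stable regular models upstairs.  KIND
CONSUMED (hypothesis-free): totally tamely ramified cyclic tops `G = G_T` with `μ_ℓ ⊆ K`, for EVERY residue field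
algebraic over `k` (g25/g26 needed `κ(O′) = k`).  HONEST LOCATED REMAINDER of the tame layer: (α2) `μ_ℓ ⊄ K`
(`ζ_ℓ ∈ K^h ∖ K` when `μ_ℓ ⊆ κ(O)`, in `K^{sh}` otherwise): Cossart–Piltant's `σ`-fixed output then lives in
`K(ζ_ℓ)` and bringing it down along the cyclotomic étale layer `K(ζ_ℓ) | K` is INPUT PRODUCTION for that layer
((K-L3) restricted) — NOT consumed, NOT claimed; (α3) `G ⊋ G_T`: decomposition / inert storeys BELOW the tame
storey are not composed here (the two-storey cell is (W-α) WHOLE, critic row 213 (t1)); (α4) non-cyclic tame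
`G_T` (several Kummer generators — possible at rank one when `Γ′/Γ` is not cyclic, e.g. `Γ = ℤ + ℤ√2`,
`Γ′ = ½Γ`) is not re-typed here either (composite ORDER of a cyclic `G_T` with `μ_ℓ ⊆ K` IS in the cell: `ℓ` is
any positive integer invertible in `k`); then (β) WILD ramification ((W-wild) mod Theorem D) and (γ) the defect /
immediate world ((K-D), (K-c)). -/
def NonKHToricArchLUKeyHenselDescentQuotTInert (e c n : ℕ) : Prop :=
  ∀ p : ℕ, p.Prime → ∀ (k K : Type) [Field k] [CharP k p] [Field K] [Algebra k K],
    Algebra.trdeg k K ≤ n → ∀ O : ValuationSubring K, Nonempty O.valuation.RankOne →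
    (∀ y ∈ O, ∃ f : Polynomial k, f ≠ 0 ∧ Polynomial.aeval y f ∈ O.nonunits) →
    ¬ IsAbhyankarPlace O (algebraMap k K).fieldRange ⊤ →
    ¬ (∃ d : ℕ, d < n ∧ SepDenseBelow k O d) → ¬ ToricDenseBelow k O e → ¬ KHTopBelow k O c →
    ¬ KeyChainTopBelow k O → ¬ HenselKeyChainTopBelow k O → ¬ GaloisHenselDescentDatum k O →
    ¬ TameQuotientLU.TameEquivariantLUAbove k O →
    ¬ DecompositionFieldLUAbove k O → ¬ DecWitnessLUAbove k O → ¬ UnramifiedWitnessLUAbove k O →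
    ¬ TameInertialLUAbove k O → RelLocalUniformization k K O

/-- Dropping the negated tame-inertial hypothesis: `R28 → R29`. [folklore] -/
theorem nonKHToricArchLUKeyHenselDescentQuotTInert_of_inert {e c n : ℕ}
    (h : NonKHToricArchLUKeyHenselDescentQuotInert e c n) : NonKHToricArchLUKeyHenselDescentQuotTInert e c n :=
  fun p hp k K _ _ _ _ hd O h1 h0 hA hnd hnt hnk hkey hH hG hT hDF hDW hU _ =>
    h p hp k K hd O h1 h0 hA hnd hnt hnk hkey hH hG hT hDF hDW hU

/-- **THE TAME-INERTIAL CUT** (kernel, exact, hypothesis-free): the g28 located residual `R28` is EQUIVALENT to its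
part off the tame-inertial cell — on the cell the law `relLU_of_tameInertialLUAbove` decides. [folklore] -/
theorem nonKHToricArchLUKeyHenselDescentQuotInert_iff_tinert {e c n : ℕ} :
    NonKHToricArchLUKeyHenselDescentQuotInert e c n ↔ NonKHToricArchLUKeyHenselDescentQuotTInert e c n := by
  refine ⟨nonKHToricArchLUKeyHenselDescentQuotTInert_of_inert,
    fun h p hp k K _ _ _ _ hd O hr hz hA hnd hnt hnk hkey hH hG hT hDF hDW hU => ?_⟩
  by_cases hI : TameInertialLUAbove k O
  · exact relLU_of_tameInertialLUAbove hI
  exact h p hp k K hd O hr hz hA hnd hnt hnk hkey hH hG hT hDF hDW hU hI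

/-- The EXACT re-location at the programme's parameters `(3, 3, 4)` (`R28 ↔ R29`, hypothesis-free). [folklore] -/
theorem nonKHToricArchLUKeyHenselDescentQuotInert334_iff_tinert :
    NonKHToricArchLUKeyHenselDescentQuotInert 3 3 4 ↔ NonKHToricArchLUKeyHenselDescentQuotTInert 3 3 4 :=
  nonKHToricArchLUKeyHenselDescentQuotInert_iff_tinert

/-- The g25 located residual re-located in one step (`R25 ↔ R29`). [folklore] -/
theorem nonKHToricArchLUKeyHenselDescentQuot_iff_tinert {e c n : ℕ} :
    NonKHToricArchLUKeyHenselDescentQuot e c n ↔ NonKHToricArchLUKeyHenselDescentQuotTInert e c n :=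
  nonKHToricArchLUKeyHenselDescentQuot_iff_inert.trans nonKHToricArchLUKeyHenselDescentQuotInert_iff_tinert

/-- The g23 located residual re-located (`R23 ↔ R29`). [folklore] -/
theorem nonKHToricArchLUKeyHenselDescent_iff_tinert {e c n : ℕ} :
    NonKHToricArchLUKeyHenselDescent e c n ↔ NonKHToricArchLUKeyHenselDescentQuotTInert e c n :=
  nonKHToricArchLUKeyHenselDescent_iff_inert.trans nonKHToricArchLUKeyHenselDescentQuotInert_iff_tinert

/-- The TRUE residual family of g17/g20 (`NonKHToricArchLU`) re-located off all seven cells. [folklore] -/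
theorem nonKHToricArchLU_iff_tinert {e c n : ℕ} :
    NonKHToricArchLU e c n ↔ NonKHToricArchLUKeyHenselDescentQuotTInert e c n :=
  nonKHToricArchLU_iff_inert.trans nonKHToricArchLUKeyHenselDescentQuotInert_iff_tinert

/-- The new residual follows from the root outright (it is a WEAKER piece). [folklore] -/
theorem nonKHToricArchLUKeyHenselDescentQuotTInert_of_root (hS : _root_.ResolutionOfSingularities)
    (e c n : ℕ) : NonKHToricArchLUKeyHenselDescentQuotTInert e c n :=
  nonKHToricArchLUKeyHenselDescentQuotTInert_of_inert (nonKHToricArchLUKeyHenselDescentQuotInert_of_root hS e c n)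

/-- **`closes_tinert` — ROOT BY NAME (binders PRINTED):** `(hCP : CossartPiltant2019LU3)` the Cossart–Piltant
dimension-3 floor (print) · `(hCJS : CossartJannsenSaito2020Embedded)` embedded resolution of excellent surfaces
(named fact) · `(hAsc : KK05NCVAscent)` the Knaf–Kuhlmann (NC)+(V) ascent Π₁ (print) · `(hN : ∀ d ≥ 4, R29 3 3 d)`
the located residual OFF the key-chain, Hensel, descent, tame-quotient, decomposition-descent, residue-free
witness AND tame-inertial cells · `(h₃ : Valuative.PatchingRel)` the patching crux 0642 ⇒ `ResolutionOfSingularities`.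
All seven cells are discharged INSIDE the kernel. [folklore] -/
theorem closes_tinert (hCP : CossartPiltant2019LU3.{0}) (hCJS : CossartJannsenSaito2020Embedded.{0})
    (hAsc : KK05NCVAscent) (hN : ∀ d, 4 ≤ d → NonKHToricArchLUKeyHenselDescentQuotTInert 3 3 d)
    (h₃ : Valuative.PatchingRel) : _root_.ResolutionOfSingularities :=
  closes_inert hCP hCJS hAsc (fun d hd => nonKHToricArchLUKeyHenselDescentQuotInert_iff_tinert.2 (hN d hd)) h₃

/-- Root-level summary: modulo floor + CJS + Π₁ + 0642 the ROOT is EQUIVALENT to the residual family off the seven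
cells. [folklore] -/
theorem root_iff_tinert_sigma (hCP : CossartPiltant2019LU3.{0})
    (hCJS : CossartJannsenSaito2020Embedded.{0}) (hAsc : KK05NCVAscent) (h₃ : Valuative.PatchingRel) :
    _root_.ResolutionOfSingularities ↔ ∀ d, 4 ≤ d → NonKHToricArchLUKeyHenselDescentQuotTInert 3 3 d := by
  rw [root_iff_inert_sigma hCP hCJS hAsc h₃]
  exact forall₂_congr fun d _ => nonKHToricArchLUKeyHenselDescentQuotInert_iff_tinert

end CutT

end Summit.ResolutionOfSingularities.ResolutionOfSingularities.Theorems.TameInertialLU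

end
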